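import Summits.HubbardSuperconductivity.HubbardSuperconductivity.Theorems.CwSsbToEvenTorusLRO.Negative.BlockStubEncoding
import Literature.MathematicalPhysics.QuantumLattice.FinDimSpectrumProofs
import Literature.MathematicalPhysics.QuantumLattice.DWaveSourceProofs

/-!
# Crux `CwSsbToEvenTorusLRO` (item `stmt-HubbardSuperconductivity-10439`): the `NoBlockKink` stub encoding, part 2 —
converse direction, automatic concavity, and the sourced caricature

Support file of the standing disprover (generation 2; workfile `Cruxes/CwSsbToEvenTorusLRO/Disproof.lean` §4b–§4c),
continuing `BlockStubEncoding.lean`; no definition is introduced. (1) `rightSecant_antitoneOn`,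
`leftSecant_monotoneOn`, `rightSecant_le_leftSecant`, `hasDerivAt_of_concave_of_encoding`,
`encoding_iff_differentiableAt`: for a CONCAVE `e` the stub's encoding `∀ε>0 ∃κ>0, -ε ≤ [e(κ)+e(-κ)-2e(0)]/κ` is
EQUIVALENT to differentiability of `e` at `0`. (2) `concaveOn_groundEnergy_affine` (the ground energy of a Hermitian
affine family `T + κW` is concave: variational principle at a unit ground vector), `concaveOn_blockPerturbedEnergy`,
`concaveOn_limit_blockPerturbedEnergy`: concavity is automatic, so `noBlockKinkAt_iff_differentiableAt_of_limit'`
needs ONLY the existence of the pointwise thermodynamic limit: the stub IS "no kink of the limiting energy density in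
the block direction". (3) `sourcedCaricature_hasDerivAt`, `sourcedCaricature_limit_not_differentiableAt`: with a
source `h > 0` the coexistence density `min(-2hm + w₁t, w₂t)` is differentiable at `t = 0` for EVERY `h > 0` while
its `h ↓ 0` limit is not — block regularity pointwise in the source does not transport; uniformity in `h` is the
content.
-/

noncomputable section

namespace Summit.HubbardSuperconductivity.HubbardSuperconductivity.Theorems.CwSsbToEvenTorusLRO.Negative

open Literature.MathematicalPhysics.QuantumLattice Literature.Barriers.HubbardSuperconductivity
open Literature.Probability.LatticeModels (TorusSite)
open Filter Set
open scoped Matrix ComplexOrder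
open _root_.Topology

/-! ### 1. One-sided secants of a concave function -/

/-- The right secant `κ ↦ (e κ - e 0)/κ` of a concave function is antitone on `(0, ∞)`. [folklore] -/
theorem rightSecant_antitoneOn {e : ℝ → ℝ} (he : ConcaveOn ℝ univ e) :
    AntitoneOn (fun κ => slope e 0 κ) (Ioi 0) := by
  intro a ha b hb hab
  have hc : ConvexOn ℝ univ (-e) := he.neg
  have s1 := hc.secant_mono (a := 0) (x := a) (y := b) (mem_univ _) (mem_univ _) (mem_univ _)
    (ne_of_gt ha) (ne_of_gt hb) hab
  simp only [Pi.neg_apply] at s1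
  show slope e 0 b ≤ slope e 0 a
  rw [slope_def_field, slope_def_field]
  have e1 : (-e a - -e 0) / (a - 0) = -((e a - e 0) / (a - 0)) := by ring
  have e2 : (-e b - -e 0) / (b - 0) = -((e b - e 0) / (b - 0)) := by ring
  rw [e1, e2] at s1
  linarith

/-- The left secant `κ ↦ (e 0 - e(-κ))/κ` of a concave function is monotone on `(0, ∞)`. [folklore] -/
theorem leftSecant_monotoneOn {e : ℝ → ℝ} (he : ConcaveOn ℝ univ e) :
    MonotoneOn (fun κ => slope e 0 (-κ)) (Ioi 0) := by
  intro a ha b hb hab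
  have hc : ConvexOn ℝ univ (-e) := he.neg
  have s2 := hc.secant_mono (a := 0) (x := -b) (y := -a) (mem_univ _) (mem_univ _) (mem_univ _)
    (neg_ne_zero.2 (ne_of_gt hb)) (neg_ne_zero.2 (ne_of_gt ha)) (neg_le_neg hab)
  simp only [Pi.neg_apply] at s2
  show slope e 0 (-a) ≤ slope e 0 (-b)
  rw [slope_def_field, slope_def_field]
  have e3 : (-e (-b) - -e 0) / (-b - 0) = -((e (-b) - e 0) / (-b - 0)) := by ring
  have e4 : (-e (-a) - -e 0) / (-a - 0) = -((e (-a) - e 0) / (-a - 0)) := by ring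
  rw [e3, e4] at s2
  linarith

/-- Every right secant of a concave function is below every left secant (three-point inequality). [folklore] -/
theorem rightSecant_le_leftSecant {e : ℝ → ℝ} (he : ConcaveOn ℝ univ e) {a b : ℝ} (ha : 0 < a) (hb : 0 < b) :
    slope e 0 a ≤ slope e 0 (-b) := by
  have h := he.slope_anti_adjacent (x := -b) (y := 0) (z := a) (mem_univ _) (mem_univ _) (by linarith) ha
  rw [slope_def_field, slope_def_field]
  have e1 : (e (-b) - e 0) / (-b - 0) = (e 0 - e (-b)) / (0 - -b) := by
    rw [show (-b - 0 : ℝ) = -(0 - -b) by ring, div_neg, ← neg_div]; ring_nf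
  rw [e1]
  exact h

/-! ### 2. The encoding forces differentiability (concave case), and the equivalence -/

/-- **Converse supplier direction.** For a CONCAVE `e`, the encoding `∀ε>0 ∃κ>0, -ε ≤ [e(κ)+e(-κ)-2e(0)]/κ` forces
`HasDerivAt e d 0` with `d` the common one-sided limit of the secants. [folklore] -/
theorem hasDerivAt_of_concave_of_encoding {e : ℝ → ℝ} (he : ConcaveOn ℝ univ e)
    (h : ∀ ε : ℝ, 0 < ε → ∃ κ : ℝ, 0 < κ ∧ -ε ≤ (e κ + e (-κ) - 2 * e 0) / κ) :
    HasDerivAt e (sSup ((fun κ => slope e 0 κ) '' Ioi 0)) 0 := by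
  set r : ℝ → ℝ := fun κ => slope e 0 κ with hr
  set l : ℝ → ℝ := fun κ => slope e 0 (-κ) with hl
  have hra : AntitoneOn r (Ioi 0) := rightSecant_antitoneOn he
  have hlm : MonotoneOn l (Ioi 0) := leftSecant_monotoneOn he
  have hrl : ∀ a b : ℝ, 0 < a → 0 < b → r a ≤ l b := fun a b ha hb => rightSecant_le_leftSecant he ha hb
  have hne : (Ioi (0:ℝ)).Nonempty := ⟨1, by norm_num⟩
  have hbddr : BddAbove (r '' Ioi 0) := ⟨l 1, by rintro _ ⟨a, ha, rfl⟩; exact hrl a 1 ha one_pos⟩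
  have hbddl : BddBelow (l '' Ioi 0) := ⟨r 1, by rintro _ ⟨b, hb, rfl⟩; exact hrl 1 b one_pos hb⟩
  set R := sSup (r '' Ioi 0) with hR
  set Λ := sInf (l '' Ioi 0) with hΛ
  have htr : Tendsto r (𝓝[>] 0) (𝓝 R) := hra.tendsto_nhdsGT hbddr
  have htl : Tendsto l (𝓝[>] 0) (𝓝 Λ) := hlm.tendsto_nhdsGT hbddl
  have hRΛ : R ≤ Λ := by
    refine csSup_le (hne.image _) ?_
    rintro _ ⟨a, ha, rfl⟩
    refine le_csInf (hne.image _) ?_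
    rintro _ ⟨b, hb, rfl⟩
    exact hrl a b ha hb
  have hΛR : Λ ≤ R := by
    have hdiff : Tendsto (fun κ => r κ - l κ) (𝓝[>] 0) (𝓝 (R - Λ)) := htr.sub htl
    by_contra hcon
    push Not at hcon
    obtain ⟨κ, hκ, hk⟩ := h ((Λ - R) / 2) (by linarith)
    have hev : ∀ᶠ κ' in 𝓝[>] (0:ℝ), -((Λ - R) / 2) ≤ r κ' - l κ' := by
      filter_upwards [Ioo_mem_nhdsGT hκ] with κ' hκ'
      have h1 : r κ ≤ r κ' := hra hκ'.1 hκ (le_of_lt hκ'.2)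
      have h2 : l κ' ≤ l κ := hlm hκ'.1 hκ (le_of_lt hκ'.2)
      have h3 : (e κ + e (-κ) - 2 * e 0) / κ = r κ - l κ := symmSecondDiff_eq_slope e κ
      linarith
    have hlim : -((Λ - R) / 2) ≤ R - Λ := ge_of_tendsto hdiff hev
    linarith
  have hEq : R = Λ := le_antisymm hRΛ hΛR
  rw [hasDerivAt_iff_tendsto_slope, ← nhdsLT_sup_nhdsGT, tendsto_sup]
  constructor
  · have hneg : Tendsto (fun t : ℝ => -t) (𝓝[<] (0:ℝ)) (𝓝[>] 0) := by
      simpa using tendsto_neg_nhdsLT (a := (0:ℝ))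
    have := htl.comp hneg
    rw [← hEq] at this
    refine this.congr' (Filter.Eventually.of_forall fun t => ?_)
    simp [hl]
  · exact htr

/-- **For a concave density: the `NoBlockKink` encoding ⟺ differentiability at `0`.** [folklore] -/
theorem encoding_iff_differentiableAt {e : ℝ → ℝ} (he : ConcaveOn ℝ univ e) :
    (∀ ε : ℝ, 0 < ε → ∃ κ : ℝ, 0 < κ ∧ -ε ≤ (e κ + e (-κ) - 2 * e 0) / κ) ↔ DifferentiableAt ℝ e 0 := by
  refine ⟨fun h => (hasDerivAt_of_concave_of_encoding he h).differentiableAt, fun hd ε hε => ?_⟩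
  have ht := tendsto_symmSecondDiff_of_differentiableAt hd
  have hev : ∀ᶠ κ in 𝓝[≠] (0:ℝ), |(e κ + e (-κ) - 2 * e 0) / κ| < ε := by
    have := (Metric.tendsto_nhds.1 ht) ε hε
    filter_upwards [this] with κ hκ
    rw [Real.dist_eq, sub_zero] at hκ
    exact hκ
  have hev' : ∀ᶠ κ in 𝓝[>] (0:ℝ), |(e κ + e (-κ) - 2 * e 0) / κ| < ε ∧ 0 < κ :=
    (hev.filter_mono (nhdsWithin_mono _ fun x hx => ne_of_gt hx)).and self_mem_nhdsWithin
  obtain ⟨κ, hκ, hκpos⟩ := hev'.exists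
  exact ⟨κ, hκpos, (abs_lt.1 hκ).1.le⟩

/-- **Modulo the thermodynamic limit the stub IS differentiability (both directions).** If the zero-source
block-perturbed grand-canonical energy density `E₀(K_μ + κW_R)/L²` (block operator spelled out as in
`noBlockKinkAt_of_limit`) converges pointwise near `κ = 0` to a CONCAVE `e` (it is concave: each finite-`L` energy
is a minimum of affine functions of `κ`), then the stub `NoBlockKink` at scale `R` holds iff `e` is differentiable
at `0`. [folklore] -/
theorem noBlockKinkAt_iff_differentiableAt_of_limit {U μ : ℝ} {R : ℕ} {e : ℝ → ℝ}
    (hlim : ∀ κ : ℝ, Tendsto (fun L : ℕ =>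
      (dWaveSourceTorus (L + 1) U μ 0 + (κ : ℂ) • (((((R : ℝ) ^ 4)⁻¹ : ℝ) : ℂ) •
        ∑ a : TorusSite 2 (L + 1),
          (∑ u : Fin 2 → Fin R, localPair dWaveFormFactor (L + 1) (a + fun i => ((u i : ℕ) : ZMod (L + 1))))ᴴ *
            (∑ u : Fin 2 → Fin R,
              localPair dWaveFormFactor (L + 1) (a + fun i => ((u i : ℕ) : ZMod (L + 1)))))).groundEnergy /
        ((L + 1 : ℕ) : ℝ) ^ 2) atTop (𝓝 (e κ)))
    (he : ConcaveOn ℝ univ e) :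
    (∀ ε : ℝ, 0 < ε → ∃ κ : ℝ, 0 < κ ∧ ∀ᶠ L : ℕ in atTop,
      -(ε * κ) * ((L + 1 : ℕ) : ℝ) ^ 2 ≤
        (dWaveSourceTorus (L + 1) U μ 0 + (κ : ℂ) • (((((R : ℝ) ^ 4)⁻¹ : ℝ) : ℂ) •
          ∑ a : TorusSite 2 (L + 1),
            (∑ u : Fin 2 → Fin R, localPair dWaveFormFactor (L + 1) (a + fun i => ((u i : ℕ) : ZMod (L + 1))))ᴴ *
              (∑ u : Fin 2 → Fin R,
                localPair dWaveFormFactor (L + 1) (a + fun i => ((u i : ℕ) : ZMod (L + 1)))))).groundEnergy +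
        (dWaveSourceTorus (L + 1) U μ 0 + ((-κ : ℝ) : ℂ) • (((((R : ℝ) ^ 4)⁻¹ : ℝ) : ℂ) •
          ∑ a : TorusSite 2 (L + 1),
            (∑ u : Fin 2 → Fin R, localPair dWaveFormFactor (L + 1) (a + fun i => ((u i : ℕ) : ZMod (L + 1))))ᴴ *
              (∑ u : Fin 2 → Fin R,
                localPair dWaveFormFactor (L + 1) (a + fun i => ((u i : ℕ) : ZMod (L + 1)))))).groundEnergy -
        2 * (dWaveSourceTorus (L + 1) U μ 0 + ((0 : ℝ) : ℂ) • (((((R : ℝ) ^ 4)⁻¹ : ℝ) : ℂ) •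
          ∑ a : TorusSite 2 (L + 1),
            (∑ u : Fin 2 → Fin R, localPair dWaveFormFactor (L + 1) (a + fun i => ((u i : ℕ) : ZMod (L + 1))))ᴴ *
              (∑ u : Fin 2 → Fin R,
                localPair dWaveFormFactor (L + 1) (a + fun i => ((u i : ℕ) : ZMod (L + 1)))))).groundEnergy) ↔
    DifferentiableAt ℝ e 0 := by
  -- abbreviate the finite-`L` energy
  set E : ℕ → ℝ → ℝ := fun L κ =>
      (dWaveSourceTorus (L + 1) U μ 0 + (κ : ℂ) • (((((R : ℝ) ^ 4)⁻¹ : ℝ) : ℂ) •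
        ∑ a : TorusSite 2 (L + 1),
          (∑ u : Fin 2 → Fin R, localPair dWaveFormFactor (L + 1) (a + fun i => ((u i : ℕ) : ZMod (L + 1))))ᴴ *
            (∑ u : Fin 2 → Fin R,
              localPair dWaveFormFactor (L + 1) (a + fun i => ((u i : ℕ) : ZMod (L + 1)))))).groundEnergy
    with hE
  change (∀ ε : ℝ, 0 < ε → ∃ κ : ℝ, 0 < κ ∧ ∀ᶠ L : ℕ in atTop,
      -(ε * κ) * ((L + 1 : ℕ) : ℝ) ^ 2 ≤ E L κ + E L (-κ) - 2 * E L 0) ↔ DifferentiableAt ℝ e 0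
  have hA : ∀ᶠ L : ℕ in atTop, (0:ℝ) < ((L + 1 : ℕ) : ℝ) ^ 2 :=
    Filter.Eventually.of_forall fun L => by positivity
  refine ⟨fun hK => (encoding_iff_differentiableAt he).1 fun ε hε => ?_,
    fun hd => noKinkEncoding_of_limit (E := E) (A := fun L => ((L + 1 : ℕ) : ℝ) ^ 2) hA hlim hd⟩
  obtain ⟨κ, hκ, hev⟩ := hK ε hε
  refine ⟨κ, hκ, ?_⟩
  have hl : Tendsto (fun L : ℕ => (E L κ + E L (-κ) - 2 * E L 0) / ((L + 1 : ℕ) : ℝ) ^ 2) atTop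
      (𝓝 (e κ + e (-κ) - 2 * e 0)) := by
    have := ((hlim κ).add (hlim (-κ))).sub ((hlim 0).const_mul 2)
    refine this.congr' (Filter.Eventually.of_forall fun L => ?_)
    have hAL : (0:ℝ) < ((L + 1 : ℕ) : ℝ) ^ 2 := by positivity
    show E L κ / ((L + 1 : ℕ) : ℝ) ^ 2 + E L (-κ) / ((L + 1 : ℕ) : ℝ) ^ 2 - 2 * (E L 0 / ((L + 1 : ℕ) : ℝ) ^ 2) =
      (E L κ + E L (-κ) - 2 * E L 0) / ((L + 1 : ℕ) : ℝ) ^ 2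
    field_simp
  have hev' : ∀ᶠ L : ℕ in atTop, -(ε * κ) ≤ (E L κ + E L (-κ) - 2 * E L 0) / ((L + 1 : ℕ) : ℝ) ^ 2 := by
    filter_upwards [hev] with L hL
    have hAL : (0:ℝ) < ((L + 1 : ℕ) : ℝ) ^ 2 := by positivity
    rw [le_div_iff₀ hAL]
    exact hL
  have hle : -(ε * κ) ≤ e κ + e (-κ) - 2 * e 0 := ge_of_tendsto hl hev'
  rw [le_div_iff₀ hκ]
  linarith

/-! ### 2b. Concavity is automatic: the ground energy of an affine Hermitian family is concave -/

section GroundEnergyConcavity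

open Matrix

variable {n : Type*} [Fintype n] [DecidableEq n]

/-- A Hermitian matrix on a nonempty index type has a unit ground vector attaining the ground energy (pattern of
`minEnergyOn_top_holds`). [folklore] -/
theorem exists_unit_groundVector {A : Matrix n n ℂ} (hA : A.IsHermitian) [Nonempty n] :
    ∃ ψ : n → ℂ, star ψ ⬝ᵥ ψ = 1 ∧ (star ψ ⬝ᵥ A *ᵥ ψ).re = A.groundEnergy := by
  have hne : ∃ ψ : n → ℂ, ψ ∈ A.groundSpace ∧ star ψ ⬝ᵥ ψ = 1 := by
    obtain ⟨v, hv, hv0⟩ := (Submodule.ne_bot_iff _).1 (groundSpace_ne_bot_holds hA)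
    have hpos : 0 < ‖(WithLp.toLp 2 v : EuclideanSpace ℂ n)‖ := by
      rw [norm_pos_iff]; exact fun h => hv0 (by simpa using congrArg WithLp.ofLp h)
    refine ⟨((‖(WithLp.toLp 2 v : EuclideanSpace ℂ n)‖ : ℂ))⁻¹ • v, A.groundSpace.smul_mem _ hv, ?_⟩
    have h1 : inner ℂ (WithLp.toLp 2 v : EuclideanSpace ℂ n) (WithLp.toLp 2 v) = star v ⬝ᵥ v := by
      rw [EuclideanSpace.inner_eq_star_dotProduct, dotProduct_comm]
    have hvv : star v ⬝ᵥ v = ((‖(WithLp.toLp 2 v : EuclideanSpace ℂ n)‖ : ℂ)) ^ 2 := by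
      rw [← h1, inner_self_eq_norm_sq_to_K]
      rfl
    rw [star_smul, smul_dotProduct, dotProduct_smul, hvv, smul_eq_mul, smul_eq_mul]
    have hc0 : ((‖(WithLp.toLp 2 v : EuclideanSpace ℂ n)‖ : ℂ)) ≠ 0 := by
      exact_mod_cast hpos.ne'
    simp only [Complex.star_def, map_inv₀, Complex.conj_ofReal]
    field_simp
  obtain ⟨ψ, hψ, hψ1⟩ := hne
  exact ⟨ψ, hψ1, (rayleigh_eq_groundEnergy_iff_holds hA ψ hψ1).2 hψ⟩

omit [Fintype n] [DecidableEq n] in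
/-- `T + κW` is Hermitian for real `κ`. [folklore] -/
theorem isHermitian_add_real_smul {T W : Matrix n n ℂ} (hT : T.IsHermitian) (hW : W.IsHermitian) (κ : ℝ) :
    (T + (κ : ℂ) • W).IsHermitian :=
  hT.add (Matrix.IsHermitian.smul hW (by rw [isSelfAdjoint_iff, Complex.star_def, Complex.conj_ofReal]))

omit [DecidableEq n] in
/-- The Rayleigh quotient is affine in `κ`. [folklore] -/
theorem re_rayleigh_affine (T W : Matrix n n ℂ) (ψ : n → ℂ) (κ : ℝ) :
    (star ψ ⬝ᵥ (T + (κ : ℂ) • W) *ᵥ ψ).re = (star ψ ⬝ᵥ T *ᵥ ψ).re + κ * (star ψ ⬝ᵥ W *ᵥ ψ).re := by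
  rw [add_mulVec, smul_mulVec, dotProduct_add, dotProduct_smul, Complex.add_re, smul_eq_mul,
    Complex.re_ofReal_mul]

/-- **The ground energy is concave along an affine Hermitian family `κ ↦ T + κW`**: a minimum of affine functions
of `κ` (variational principle at a unit ground vector of the interpolated matrix). [folklore] -/
theorem concaveOn_groundEnergy_affine {T W : Matrix n n ℂ} (hT : T.IsHermitian) (hW : W.IsHermitian)
    [Nonempty n] : ConcaveOn ℝ univ (fun κ : ℝ => (T + (κ : ℂ) • W).groundEnergy) := by
  refine ⟨convex_univ, fun x _ y _ a b ha hb hab => ?_⟩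
  simp only [smul_eq_mul]
  obtain ⟨ψ, hψ1, hψE⟩ := exists_unit_groundVector (isHermitian_add_real_smul hT hW (a * x + b * y))
  have hx := groundEnergy_le_rayleigh_holds (isHermitian_add_real_smul hT hW x) ψ hψ1
  have hy := groundEnergy_le_rayleigh_holds (isHermitian_add_real_smul hT hW y) ψ hψ1
  rw [re_rayleigh_affine] at hx hy hψE
  rw [← hψE]
  set t := (star ψ ⬝ᵥ T *ᵥ ψ).re with ht
  set w := (star ψ ⬝ᵥ W *ᵥ ψ).re with hw
  have h1 := mul_le_mul_of_nonneg_left hx ha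
  have h2 := mul_le_mul_of_nonneg_left hy hb
  have h3 : a * (t + x * w) + b * (t + y * w) = t + (a * x + b * y) * w := by
    calc a * (t + x * w) + b * (t + y * w) = (a + b) * t + (a * x + b * y) * w := by ring
      _ = t + (a * x + b * y) * w := by rw [hab]; ring
  linarith [h1, h2, h3]

/-- A pointwise limit of concave functions is concave. [folklore] -/
theorem concaveOn_of_tendsto {f : ℕ → ℝ → ℝ} {g : ℝ → ℝ} (hf : ∀ L, ConcaveOn ℝ univ (f L))
    (hlim : ∀ x, Tendsto (fun L => f L x) atTop (𝓝 (g x))) : ConcaveOn ℝ univ g := by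
  refine ⟨convex_univ, fun x _ y _ a b ha hb hab => ?_⟩
  have h1 : Tendsto (fun L => a • f L x + b • f L y) atTop (𝓝 (a • g x + b • g y)) :=
    ((hlim x).const_smul a).add ((hlim y).const_smul b)
  have h2 : Tendsto (fun L => f L (a • x + b • y)) atTop (𝓝 (g (a • x + b • y))) := hlim _
  exact le_of_tendsto_of_tendsto' h1 h2 fun L => (hf L).2 (mem_univ _) (mem_univ _) ha hb hab

/-- Division by a nonnegative constant preserves concavity. [folklore] -/
theorem concaveOn_div_const {f : ℝ → ℝ} (hf : ConcaveOn ℝ univ f) {c : ℝ} (hc : 0 ≤ c) :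
    ConcaveOn ℝ univ (fun x => f x / c) := by
  have := hf.smul (inv_nonneg.2 hc)
  refine ⟨convex_univ, fun x hx y hy a b ha hb hab => ?_⟩
  have h := this.2 hx hy ha hb hab
  simp only [smul_eq_mul] at h ⊢
  rw [div_eq_inv_mul, div_eq_inv_mul, div_eq_inv_mul]
  nlinarith [h]

end GroundEnergyConcavity

/-- The Kac block operator `W_R = R⁻⁴ Σ_a B_aᴴ B_a` (spelled out) is Hermitian. [folklore] -/
theorem isHermitian_kacBlockOp (L : ℕ) [NeZero L] (R : ℕ) :
    ((((((R : ℝ) ^ 4)⁻¹ : ℝ) : ℂ) • ∑ a : TorusSite 2 L,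
      (∑ u : Fin 2 → Fin R, localPair dWaveFormFactor L (a + fun i => ((u i : ℕ) : ZMod L)))ᴴ *
        (∑ u : Fin 2 → Fin R, localPair dWaveFormFactor L (a + fun i => ((u i : ℕ) : ZMod L))))).IsHermitian := by
  unfold Matrix.IsHermitian
  rw [Matrix.conjTranspose_smul, Matrix.conjTranspose_sum]
  congr 1
  · rw [Complex.star_def, Complex.conj_ofReal]
  · refine Finset.sum_congr rfl fun a _ => ?_
    rw [Matrix.conjTranspose_mul, Matrix.conjTranspose_conjTranspose]

/-- **`κ ↦ E₀(K_μ - h(P+Pᴴ) + κ W_R)` is concave** (finite `L`). [folklore] -/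
theorem concaveOn_blockPerturbedEnergy (L : ℕ) [NeZero L] (R : ℕ) (U μ h : ℝ) :
    ConcaveOn ℝ univ (fun κ : ℝ => (dWaveSourceTorus L U μ h + (κ : ℂ) • (((((R : ℝ) ^ 4)⁻¹ : ℝ) : ℂ) •
      ∑ a : TorusSite 2 L,
        (∑ u : Fin 2 → Fin R, localPair dWaveFormFactor L (a + fun i => ((u i : ℕ) : ZMod L)))ᴴ *
          (∑ u : Fin 2 → Fin R, localPair dWaveFormFactor L (a + fun i => ((u i : ℕ) : ZMod L))))).groundEnergy) := by
  haveI : Nonempty (Finset (Orb (FermionTorus 2 L))) := ⟨∅⟩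
  exact concaveOn_groundEnergy_affine (dWaveSourceTorus_isHermitian L (isHermitian_hubbardTorusWith L 1 U μ) h)
    (isHermitian_kacBlockOp L R)

/-- **If the thermodynamic limit of the block-perturbed energy density exists, it is concave.** [folklore] -/
theorem concaveOn_limit_blockPerturbedEnergy {U μ : ℝ} {R : ℕ} {e : ℝ → ℝ}
    (hlim : ∀ κ : ℝ, Tendsto (fun L : ℕ =>
      (dWaveSourceTorus (L + 1) U μ 0 + (κ : ℂ) • (((((R : ℝ) ^ 4)⁻¹ : ℝ) : ℂ) •
        ∑ a : TorusSite 2 (L + 1),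
          (∑ u : Fin 2 → Fin R, localPair dWaveFormFactor (L + 1) (a + fun i => ((u i : ℕ) : ZMod (L + 1))))ᴴ *
            (∑ u : Fin 2 → Fin R,
              localPair dWaveFormFactor (L + 1) (a + fun i => ((u i : ℕ) : ZMod (L + 1)))))).groundEnergy /
        ((L + 1 : ℕ) : ℝ) ^ 2) atTop (𝓝 (e κ))) : ConcaveOn ℝ univ e :=
  concaveOn_of_tendsto (f := fun L κ =>
      (dWaveSourceTorus (L + 1) U μ 0 + (κ : ℂ) • (((((R : ℝ) ^ 4)⁻¹ : ℝ) : ℂ) •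
        ∑ a : TorusSite 2 (L + 1),
          (∑ u : Fin 2 → Fin R, localPair dWaveFormFactor (L + 1) (a + fun i => ((u i : ℕ) : ZMod (L + 1))))ᴴ *
            (∑ u : Fin 2 → Fin R,
              localPair dWaveFormFactor (L + 1) (a + fun i => ((u i : ℕ) : ZMod (L + 1)))))).groundEnergy /
        ((L + 1 : ℕ) : ℝ) ^ 2)
    (fun L => concaveOn_div_const (concaveOn_blockPerturbedEnergy (L + 1) R U μ 0) (by positivity)) hlim

/-- **Hypothesis-minimal equivalence**: if the pointwise thermodynamic limit `e` of the block-perturbed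
grand-canonical energy density exists near `κ = 0`, then the stub `NoBlockKink` at scale `R` holds iff `e` is
differentiable at `0` (concavity being automatic). [folklore] -/
theorem noBlockKinkAt_iff_differentiableAt_of_limit' {U μ : ℝ} {R : ℕ} {e : ℝ → ℝ}
    (hlim : ∀ κ : ℝ, Tendsto (fun L : ℕ =>
      (dWaveSourceTorus (L + 1) U μ 0 + (κ : ℂ) • (((((R : ℝ) ^ 4)⁻¹ : ℝ) : ℂ) •
        ∑ a : TorusSite 2 (L + 1),
          (∑ u : Fin 2 → Fin R, localPair dWaveFormFactor (L + 1) (a + fun i => ((u i : ℕ) : ZMod (L + 1))))ᴴ *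
            (∑ u : Fin 2 → Fin R,
              localPair dWaveFormFactor (L + 1) (a + fun i => ((u i : ℕ) : ZMod (L + 1)))))).groundEnergy /
        ((L + 1 : ℕ) : ℝ) ^ 2) atTop (𝓝 (e κ))) :
    (∀ ε : ℝ, 0 < ε → ∃ κ : ℝ, 0 < κ ∧ ∀ᶠ L : ℕ in atTop,
      -(ε * κ) * ((L + 1 : ℕ) : ℝ) ^ 2 ≤
        (dWaveSourceTorus (L + 1) U μ 0 + (κ : ℂ) • (((((R : ℝ) ^ 4)⁻¹ : ℝ) : ℂ) •
          ∑ a : TorusSite 2 (L + 1),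
            (∑ u : Fin 2 → Fin R, localPair dWaveFormFactor (L + 1) (a + fun i => ((u i : ℕ) : ZMod (L + 1))))ᴴ *
              (∑ u : Fin 2 → Fin R,
                localPair dWaveFormFactor (L + 1) (a + fun i => ((u i : ℕ) : ZMod (L + 1)))))).groundEnergy +
        (dWaveSourceTorus (L + 1) U μ 0 + ((-κ : ℝ) : ℂ) • (((((R : ℝ) ^ 4)⁻¹ : ℝ) : ℂ) •
          ∑ a : TorusSite 2 (L + 1),
            (∑ u : Fin 2 → Fin R, localPair dWaveFormFactor (L + 1) (a + fun i => ((u i : ℕ) : ZMod (L + 1))))ᴴ *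
              (∑ u : Fin 2 → Fin R,
                localPair dWaveFormFactor (L + 1) (a + fun i => ((u i : ℕ) : ZMod (L + 1)))))).groundEnergy -
        2 * (dWaveSourceTorus (L + 1) U μ 0 + ((0 : ℝ) : ℂ) • (((((R : ℝ) ^ 4)⁻¹ : ℝ) : ℂ) •
          ∑ a : TorusSite 2 (L + 1),
            (∑ u : Fin 2 → Fin R, localPair dWaveFormFactor (L + 1) (a + fun i => ((u i : ℕ) : ZMod (L + 1))))ᴴ *
              (∑ u : Fin 2 → Fin R,
                localPair dWaveFormFactor (L + 1) (a + fun i => ((u i : ℕ) : ZMod (L + 1)))))).groundEnergy) ↔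
    DifferentiableAt ℝ e 0 :=
  noBlockKinkAt_iff_differentiableAt_of_limit hlim (concaveOn_limit_blockPerturbedEnergy hlim)

/-! ### 3. The sourced coexistence caricature: pointwise-in-`h` regularity does not transport -/

/-- With a source `h > 0` favouring phase 1 by `-2hm`, the coexistence density `f_h(t) = min(-2hm + w₁t, w₂t)` is
AFFINE near `t = 0` (the kink sits at `t_c(h) = 2hm/(w₁ - w₂) > 0`), hence differentiable at `0` with slope `w₁`
for EVERY `h > 0`. [folklore] -/
theorem sourcedCaricature_hasDerivAt {w₁ w₂ m h : ℝ} (hw : w₂ < w₁) (hm : 0 < m) (hh : 0 < h) :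
    HasDerivAt (fun t => min (-(2 * h * m) + w₁ * t) (w₂ * t)) w₁ 0 := by
  have haff : HasDerivAt (fun t : ℝ => -(2 * h * m) + w₁ * t) w₁ 0 := by
    simpa using ((hasDerivAt_id (0:ℝ)).const_mul w₁).const_add (-(2 * h * m))
  refine haff.congr_of_eventuallyEq ?_
  have hpos : 0 < 2 * h * m / (w₁ - w₂) := div_pos (by positivity) (by linarith)
  have hmem : Ioo (-(2 * h * m / (w₁ - w₂))) (2 * h * m / (w₁ - w₂)) ∈ 𝓝 (0:ℝ) :=
    Ioo_mem_nhds (by linarith) hpos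
  filter_upwards [hmem] with t ht
  refine min_eq_left ?_
  have ht2 : t * (w₁ - w₂) < 2 * h * m := by
    have := ht.2
    rwa [lt_div_iff₀ (by linarith : (0:ℝ) < w₁ - w₂)] at this
  nlinarith

/-- … while the `h ↓ 0` limit `f_0(t) = min(w₁t, w₂t)` is NOT differentiable at `0` (its symmetric quotient is
constantly `w₂ - w₁ ≠ 0`, `symmSecondDiff_coexistence`). [folklore] -/
theorem sourcedCaricature_limit_not_differentiableAt {w₁ w₂ : ℝ} (hw : w₂ < w₁) :
    ¬ DifferentiableAt ℝ (fun t => min (w₁ * t) (w₂ * t)) 0 := by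
  intro hd
  have ht := tendsto_symmSecondDiff_of_differentiableAt hd
  have ht' : Tendsto (fun κ => (min (w₁ * κ) (w₂ * κ) + min (w₁ * -κ) (w₂ * -κ) - 2 * min (w₁ * 0) (w₂ * 0)) / κ)
      (𝓝[>] 0) (𝓝 0) :=
    ht.mono_left (nhdsWithin_mono _ fun x hx => ne_of_gt hx)
  have hconst : ∀ᶠ κ in 𝓝[>] (0:ℝ),
      (min (w₁ * κ) (w₂ * κ) + min (w₁ * -κ) (w₂ * -κ) - 2 * min (w₁ * 0) (w₂ * 0)) / κ = w₂ - w₁ := by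
    filter_upwards [self_mem_nhdsWithin] with κ hκ using symmSecondDiff_coexistence hw hκ
  have ht'' : Tendsto (fun _ : ℝ => w₂ - w₁) (𝓝[>] (0:ℝ)) (𝓝 0) := ht'.congr' hconst
  have := tendsto_nhds_unique ht'' tendsto_const_nhds
  linarith

end Summit.HubbardSuperconductivity.HubbardSuperconductivity.Theorems.CwSsbToEvenTorusLRO.Negative

end
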